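import Mathlib.GroupTheory.SpecificGroups.Dihedral
import Mathlib.Tactic.Linarith
import Mathlib.Tactic.Ring
import Mathlib.Tactic.Positivity
import Literature.Combinatorics.Additive.TripleProductProperty
import Summits.MatrixMultiplication.OmegaCensus.DihedralTPPUpperBound
import Summits.MatrixMultiplication.OmegaCensus.DihedralLawModThree
import Summits.MatrixMultiplication.OmegaCensus.Dihedral8TPPVolume
import HarnessLib

/-!
# The dihedral law for `n ≡ 1 (mod 3)`: exact except at centred hexagonal numbers

ω-census, family (b3).  Framing: lottery ticket; floor = certified bounds/negative ranges.

For `n ≡ 1 (mod 3)` the counting bound `3|S||T||U| ≤ 8n` of `DihedralTPPUpperBound.lean` exceeds the census law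
`4⌊2n/3⌋` by `2`.  Here the slack is analysed completely.  Writing `X = s₁t₀u₀, Y = s₀t₁u₀, Z = s₀t₀u₁` (so that
`X+Y+Z = A₁`, `XY+YZ+ZX = A₀A₂`, `XYZ = A₀²A₃` identically) the four counting constraints force, whenever the
volume exceeds the law (`3V ≥ 8n−5`, `n = 3q+1 ≥ 7`):
* `A₁ = A₂ = n` and `{A₀, A₃} ⊆ {q−1, q}` with `A₀ + A₃ ≥ 2q−1` (`avec_mod_one`, integrality + Newton);
* the cubic discriminant `e₁²e₂²−4e₂³−4e₁³e₃−27e₃²+18e₁e₂e₃ = ((X−Y)(Y−Z)(Z−X))² ≥ 0` (`disc_identity`) then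
  excludes `(A₀,A₃) = (q−1,q), (q,q−1)` (value `−(27q+5)(q−1)³ < 0`) and for `(q,q)` gives `q²(4q+1) = □`, i.e.
  `q = m(m+1)` (`eq_mul_succ_of_sq`), i.e. `n = 3m²+3m+1` is a CENTRED HEXAGONAL number, with volume exactly
  `law + 2` (`core_nat_mod_one`).

Consequences (`tpp_volume_mod_one_dichotomy`, `tpp_volume_le_law_of_not_hex`, `dihedral_law_complete`): for every
`n ≥ 3` that is not of the form `3m²+3m+1` the exact TPP capacity of the dihedral group is
**`β(D_{2n}) = 4⌊2n/3⌋`** (both halves kernel; `n = 4` from `Dihedral8TPPVolume.lean`, `n ≢ 1` from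
`DihedralLawModThree.lean`), and at a centred hexagonal `n` it is `4⌊2n/3⌋` or `4⌊2n/3⌋ + 2`, the latter iff the
single surviving size pattern `(2, 2m+1, 2m+1)` with coset splits `(1,1),(m,m+1),(m+1,m)` is realizable — a finite
double-tiling question in `ZMod n`, decided negatively by search for `n = 7, 19, 37` (seat notes; not in the kernel).
-/

namespace Summit.MatrixMultiplication.OmegaCensus

open Literature.Combinatorics.Additive Finset DihedralGroup

/-! ## A-level classification for `n ≡ 1 (mod 3)` -/

/-- Half of the near-equality analysis (`A₂ ≤ A₁`): for integers `0 ≤ Aᵢ ≤ n` (`n ≥ 7`, `n ≡ 1 (mod 3)`) with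
Newton's inequalities, `3(A₀+A₁+A₂+A₃) ≥ 8n − 5` forces `A₁ = A₂ = n`. [folklore] -/
theorem avec_mod_one_aux (n A₀ A₁ A₂ A₃ : ℤ) (hA₀ : 0 ≤ A₀) (hA₁ : 0 ≤ A₁) (hA₂ : 0 ≤ A₂)
    (h₀ : A₀ ≤ n) (h₁ : A₁ ≤ n) (h₂ : A₂ ≤ n) (h₃ : A₃ ≤ n)
    (hN₁ : 3 * A₀ * A₂ ≤ A₁ ^ 2) (hN₂ : 3 * A₁ * A₃ ≤ A₂ ^ 2) (h21 : A₂ ≤ A₁) (hmod : n % 3 = 1) (hn : 7 ≤ n)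
    (hV : 8 * n - 5 ≤ 3 * (A₀ + A₁ + A₂ + A₃)) : A₁ = n ∧ A₂ = n := by
  -- `A₁ > 0`
  rcases eq_or_lt_of_le hA₁ with h1 | hA1pos
  · have hA2z : A₂ = 0 := le_antisymm (h1 ▸ h21) hA₂
    exfalso; subst hA2z; rw [← h1] at hV; linarith
  -- `3 A₃ ≤ A₂`
  have h33 : A₁ * (3 * A₃) ≤ A₁ * A₂ := by nlinarith [mul_le_mul_of_nonneg_left h21 hA₂]
  have hA3 : 3 * A₃ ≤ A₂ := le_of_mul_le_mul_left h33 hA1pos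
  -- `3 A₀ + 4 A₂ ≤ 5 n`
  have hsq : 3 * A₀ * A₂ ≤ n ^ 2 := by nlinarith
  have h54 : n * (3 * A₀ + 4 * A₂) ≤ n * (5 * n) := by
    nlinarith [mul_nonneg (sub_nonneg.2 h₂) (by linarith : (0:ℤ) ≤ 4 * n - 3 * A₀)]
  have h54' : 3 * A₀ + 4 * A₂ ≤ 5 * n := le_of_mul_le_mul_left h54 (by linarith)
  -- hence `A₁ ≥ n - 1`
  have hA1ge : n - 1 ≤ A₁ := by omega
  have e : n * (5 * n - 3 * A₀ - 4 * A₂) = (n ^ 2 - 3 * A₀ * A₂) + (n - A₂) * (4 * n - 3 * A₀) := by ring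
  rcases eq_or_lt_of_le hA1ge with hA1eq | hA1gt
  · -- `A₁ = n - 1` is impossible
    exfalso
    have hlow : 5 * n - 2 ≤ 3 * A₀ + 4 * A₂ := by omega
    have hsq' : 3 * A₀ * A₂ ≤ (n - 1) ^ 2 := by rw [hA1eq]; exact hN₁
    nlinarith [mul_nonneg (sub_nonneg.2 h₂) (sub_nonneg.2 h₀), mul_nonneg (sub_nonneg.2 h₂) (by linarith : (0:ℤ) ≤ n)]
  have hA1n : A₁ = n := by omega
  subst hA1n
  refine ⟨rfl, ?_⟩
  -- now `A₂ = n`: exclude `A₂ ≤ n - 2` and `A₂ = n - 1`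
  have hlow : 5 * A₁ - 5 ≤ 3 * A₀ + 4 * A₂ := by omega
  by_contra hA2ne
  have hA2lt : A₂ ≤ A₁ - 1 := by omega
  rcases eq_or_lt_of_le hA2lt with hA2eq | hA2lt'
  · -- `A₂ = n - 1`: `3A₀ ∈ [n-1, n+1]` hence `3A₀ = n - 1` (mod 3), then Newton 2 fails
    have hup : 3 * A₀ ≤ A₁ + 1 := by nlinarith
    have h3A0 : 3 * A₀ = A₁ - 1 := by omega
    have h3A3 : A₁ - 1 ≤ 3 * A₃ := by omega
    nlinarith
  · -- `A₂ ≤ n - 2`: with `k = n - A₂ ∈ {2,3,4,5}`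
    have hk5 : A₁ - A₂ ≤ 5 := by
      by_contra hk
      push Not at hk
      -- `(n - A₂)(4n - 3A₀) ≥ 6 n > 5n ≥ n(5n - 3A₀ - 4A₂)`
      nlinarith [mul_le_mul_of_nonneg_right (show (6:ℤ) ≤ A₁ - A₂ by omega) (by linarith : (0:ℤ) ≤ 4 * A₁ - 3 * A₀),
        mul_nonneg hA₀ hA₂]
    have hprod : (5 * A₁ - 5 - 4 * A₂) * A₂ ≤ 3 * A₀ * A₂ :=
      mul_le_mul_of_nonneg_right (by linarith) hA₂
    have hcases : A₂ = A₁ - 2 ∨ A₂ = A₁ - 3 ∨ A₂ = A₁ - 4 ∨ A₂ = A₁ - 5 := by omega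
    rcases hcases with h | h | h | h <;> subst h <;> nlinarith

/-- **A-level classification, `n ≡ 1 (mod 3)`.** Integers `0 ≤ Aᵢ ≤ n = 3q+1` (`n ≥ 7`) with Newton's inequalities and
`3(A₀+A₁+A₂+A₃) ≥ 8n − 5` satisfy `A₁ = A₂ = n`, `A₀, A₃ ≤ q` and `A₀ + A₃ ≥ 2q − 1`. [folklore] -/
theorem avec_mod_one (n A₀ A₁ A₂ A₃ : ℤ) (hA₀ : 0 ≤ A₀) (hA₁ : 0 ≤ A₁) (hA₂ : 0 ≤ A₂) (hA₃ : 0 ≤ A₃)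
    (h₀ : A₀ ≤ n) (h₁ : A₁ ≤ n) (h₂ : A₂ ≤ n) (h₃ : A₃ ≤ n)
    (hN₁ : 3 * A₀ * A₂ ≤ A₁ ^ 2) (hN₂ : 3 * A₁ * A₃ ≤ A₂ ^ 2) (hmod : n % 3 = 1) (hn : 7 ≤ n)
    (hV : 8 * n - 5 ≤ 3 * (A₀ + A₁ + A₂ + A₃)) :
    A₁ = n ∧ A₂ = n ∧ 3 * A₀ ≤ n - 1 ∧ 3 * A₃ ≤ n - 1 ∧ 2 * (n - 1) - 3 ≤ 3 * (A₀ + A₃) := by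
  have key : A₁ = n ∧ A₂ = n := by
    rcases le_total A₂ A₁ with h | h
    · exact avec_mod_one_aux n A₀ A₁ A₂ A₃ hA₀ hA₁ hA₂ h₀ h₁ h₂ h₃ hN₁ hN₂ h hmod hn hV
    · have := avec_mod_one_aux n A₃ A₂ A₁ A₀ hA₃ hA₂ hA₁ h₃ h₂ h₁ h₀ (by linarith) (by linarith) h hmod hn
        (by linarith)
      exact ⟨this.2, this.1⟩
  have h1' := key.1.symm
  have h2' := key.2.symm
  subst h1'
  subst h2'
  have hn0 : (0:ℤ) < n := by linarith
  refine ⟨rfl, rfl, ?_, ?_, ?_⟩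
  · -- `3 A₀ n ≤ n²` with `n > 0` gives `3A₀ ≤ n`, and `3 ∤ n`
    have : 3 * A₀ ≤ n := by
      by_contra hc
      push Not at hc
      nlinarith [mul_lt_mul_of_pos_right hc hn0]
    omega
  · have : 3 * A₃ ≤ n := by
      by_contra hc
      push Not at hc
      nlinarith [mul_lt_mul_of_pos_left hc hn0]
    omega
  · omega

/-! ## The discriminant step -/

/-- The cubic discriminant identity: for the elementary symmetric functions `e₁, e₂, e₃` of `X, Y, Z`,
`e₁²e₂² − 4e₂³ − 4e₁³e₃ − 27e₃² + 18e₁e₂e₃ = ((X−Y)(Y−Z)(Z−X))²`. [folklore] -/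
theorem disc_identity (X Y Z : ℤ) :
    (X + Y + Z) ^ 2 * (X * Y + Y * Z + Z * X) ^ 2 - 4 * (X * Y + Y * Z + Z * X) ^ 3
      - 4 * (X + Y + Z) ^ 3 * (X * Y * Z) - 27 * (X * Y * Z) ^ 2
      + 18 * (X + Y + Z) * (X * Y + Y * Z + Z * X) * (X * Y * Z) = ((X - Y) * (Y - Z) * (Z - X)) ^ 2 := by
  ring

/-- If `P² = q²(4q+1)` with `q ≥ 1` then `q = m(m+1)` for some natural `m` (so `3q+1` is a centred hexagonal
number). [folklore] -/
theorem eq_mul_succ_of_sq (q P : ℤ) (hq : 1 ≤ q) (h : P ^ 2 = q ^ 2 * (4 * q + 1)) :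
    ∃ m : ℕ, q = m * (m + 1) := by
  have hdvd : q ∣ P := by
    have : q ^ 2 ∣ P ^ 2 := ⟨4 * q + 1, by rw [h]⟩
    exact (Int.pow_dvd_pow_iff two_ne_zero).mp this
  obtain ⟨r, rfl⟩ := hdvd
  have hq0 : q ≠ 0 := by omega
  have hr : r ^ 2 = 4 * q + 1 := by
    have h' : q ^ 2 * r ^ 2 = q ^ 2 * (4 * q + 1) := by rw [← h]; ring
    exact mul_left_cancel₀ (pow_ne_zero 2 hq0) h'
  -- `r` is odd: `r = 2k+1`; then `q = k(k+1)` with `k ≥ 0` or `-k-1 ≥ 0`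
  obtain ⟨k, hk⟩ : ∃ k : ℤ, r = 2 * k + 1 := by
    have : r % 2 = 1 := by
      rcases Int.emod_two_eq_zero_or_one r with h0 | h1
      · exfalso
        obtain ⟨c, hc⟩ : (2 : ℤ) ∣ r := Int.dvd_of_emod_eq_zero h0
        subst hc
        rw [show (2 * c) ^ 2 = 4 * c ^ 2 by ring] at hr
        omega
      · exact h1
    exact ⟨r / 2, by omega⟩
  subst hk
  have hqk : q = k * (k + 1) := by nlinarith
  rcases le_or_gt 0 k with hk0 | hk0
  · exact ⟨k.toNat, by rw [Int.toNat_of_nonneg hk0]; exact hqk⟩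
  · refine ⟨(-k - 1).toNat, ?_⟩
    rw [Int.toNat_of_nonneg (by omega)]
    linear_combination hqk

/-- **Six-tuple core, `n ≡ 1 (mod 3)`.** If the coset-part sizes satisfy the four counting constraints with
`n ≡ 1 (mod 3)`, `n ≥ 7`, and `3(s₀+s₁)(t₀+t₁)(u₀+u₁) ≥ 8n − 5` (i.e. the volume exceeds the law value
`4⌊2n/3⌋`), then the volume is EXACTLY `(8n−2)/3 = law + 2` and `n = 3m²+3m+1` is a centred hexagonal number
(A-level classification + the cubic discriminant of `X = s₁t₀u₀, Y = s₀t₁u₀, Z = s₀t₀u₁`). [folklore] -/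
theorem core_nat_mod_one (n s₀ s₁ t₀ t₁ u₀ u₁ : ℕ) (hmod : n % 3 = 1) (hn : 7 ≤ n) (h₀ : s₀ * t₀ * u₀ ≤ n)
    (h₃ : s₁ * t₁ * u₁ ≤ n) (h₁ : s₁ * t₀ * u₀ + s₀ * t₁ * u₀ + s₀ * t₀ * u₁ ≤ n)
    (h₂ : s₀ * t₁ * u₁ + s₁ * t₀ * u₁ + s₁ * t₁ * u₀ ≤ n)
    (hV : 8 * n - 5 ≤ 3 * ((s₀ + s₁) * (t₀ + t₁) * (u₀ + u₁))) :
    3 * ((s₀ + s₁) * (t₀ + t₁) * (u₀ + u₁)) + 2 = 8 * n ∧ ∃ m : ℕ, n = 3 * m * m + 3 * m + 1 := by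
  set V : ℕ := (s₀ + s₁) * (t₀ + t₁) * (u₀ + u₁) with hVdef
  set A₀ : ℤ := s₀ * t₀ * u₀ with hA₀
  set A₃ : ℤ := s₁ * t₁ * u₁ with hA₃
  set X : ℤ := s₁ * t₀ * u₀ with hX
  set Y : ℤ := s₀ * t₁ * u₀ with hY
  set Z : ℤ := s₀ * t₀ * u₁ with hZ
  set X' : ℤ := s₀ * t₁ * u₁ with hX'
  set Y' : ℤ := s₁ * t₀ * u₁ with hY'
  set Z' : ℤ := s₁ * t₁ * u₀ with hZ'
  have q₀ : A₀ ≤ n := by rw [hA₀]; exact_mod_cast h₀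
  have q₃ : A₃ ≤ n := by rw [hA₃]; exact_mod_cast h₃
  have q₁ : X + Y + Z ≤ n := by rw [hX, hY, hZ]; exact_mod_cast h₁
  have q₂ : X' + Y' + Z' ≤ n := by rw [hX', hY', hZ']; exact_mod_cast h₂
  have e₁ : A₀ * (X' + Y' + Z') = X * Y + Y * Z + Z * X := by
    simp only [hA₀, hX, hY, hZ, hX', hY', hZ']; ring
  have e₂ : (X + Y + Z) * A₃ = X' * Y' + Y' * Z' + Z' * X' := by
    simp only [hA₃, hX, hY, hZ, hX', hY', hZ']; ring
  have hN₁ : 3 * A₀ * (X' + Y' + Z') ≤ (X + Y + Z) ^ 2 := by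
    nlinarith [e₁, sq_nonneg (X - Y), sq_nonneg (Y - Z), sq_nonneg (Z - X)]
  have hN₂ : 3 * (X + Y + Z) * A₃ ≤ (X' + Y' + Z') ^ 2 := by
    nlinarith [e₂, sq_nonneg (X' - Y'), sq_nonneg (Y' - Z'), sq_nonneg (Z' - X')]
  have e₃ : X * Y * Z = A₀ ^ 2 * A₃ := by
    simp only [hA₀, hA₃, hX, hY, hZ]; ring
  have e₃' : X' * Y' * Z' = A₃ ^ 2 * A₀ := by
    simp only [hA₀, hA₃, hX', hY', hZ']; ring
  have eV : (3 : ℤ) * (V : ℤ) = 3 * (A₀ + (X + Y + Z) + (X' + Y' + Z') + A₃) := by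
    simp only [hVdef, hA₀, hA₃, hX, hY, hZ, hX', hY', hZ']; push_cast; ring
  have hmod' : (n : ℤ) % 3 = 1 := by exact_mod_cast hmod
  have hn' : (7 : ℤ) ≤ n := by exact_mod_cast hn
  have hV' : 8 * (n : ℤ) - 5 ≤ 3 * (A₀ + (X + Y + Z) + (X' + Y' + Z') + A₃) := by
    rw [← eV]; have := hV; omega
  obtain ⟨hA1n, hA2n, hA0q, hA3q, hsum⟩ := avec_mod_one n A₀ (X + Y + Z) (X' + Y' + Z') A₃ (by positivity)
    (by positivity) (by positivity) (by positivity) q₀ q₁ q₂ q₃ hN₁ hN₂ hmod' hn' hV'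
  -- write `n = 3q + 1`
  obtain ⟨q, hq⟩ : ∃ q : ℤ, (n : ℤ) = 3 * q + 1 := ⟨(n : ℤ) / 3, by omega⟩
  have hdisc := disc_identity X Y Z
  have hdisc' := disc_identity X' Y' Z'
  rw [hA1n, ← e₁, hA2n, e₃] at hdisc
  rw [hA2n, ← e₂, hA1n, e₃'] at hdisc'
  -- the three candidate pairs `(A₀, A₃)`
  have hcases : (A₀ = q ∧ A₃ = q) ∨ (A₀ = q - 1 ∧ A₃ = q) ∨ (A₀ = q ∧ A₃ = q - 1) := by omega
  rcases hcases with ⟨ha0, ha3⟩ | ⟨ha0, ha3⟩ | ⟨ha0, ha3⟩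
  · -- `(q, n, n, q)`: volume `= law + 2` and `4q+1` is a square
    refine ⟨by omega, ?_⟩
    rw [ha0, ha3, hq] at hdisc
    have hsq : ((X - Y) * (Y - Z) * (Z - X)) ^ 2 = q ^ 2 * (4 * q + 1) := by
      rw [← hdisc]; ring
    obtain ⟨m, hm⟩ := eq_mul_succ_of_sq q _ (by omega) hsq
    refine ⟨m, ?_⟩
    have : (n : ℤ) = 3 * (m : ℤ) * m + 3 * m + 1 := by rw [hq, hm]; ring
    exact_mod_cast this
  · -- `(q-1, n, n, q)`: negative discriminant
    exfalso
    rw [ha0, ha3, hq] at hdisc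
    have hneg : ((X - Y) * (Y - Z) * (Z - X)) ^ 2 = -((27 * q + 5) * (q - 1) ^ 3) := by
      rw [← hdisc]; ring
    have hpos : 0 < (27 * q + 5) * (q - 1) ^ 3 := mul_pos (by omega) (pow_pos (by omega) 3)
    linarith [sq_nonneg ((X - Y) * (Y - Z) * (Z - X))]
  · -- `(q, n, n, q-1)`: negative discriminant (mirror)
    exfalso
    rw [ha0, ha3, hq] at hdisc'
    have hneg : ((X' - Y') * (Y' - Z') * (Z' - X')) ^ 2 = -((27 * q + 5) * (q - 1) ^ 3) := by
      rw [← hdisc']; ring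
    have hpos : 0 < (27 * q + 5) * (q - 1) ^ 3 := mul_pos (by omega) (pow_pos (by omega) 3)
    linarith [sq_nonneg ((X' - Y') * (Y' - Z') * (Z' - X'))]


/-! ## The dihedral law for `n ≡ 1 (mod 3)` -/

variable {n : ℕ} [NeZero n] {S T U : Finset (DihedralGroup n)}

/-- **Dichotomy for `n ≡ 1 (mod 3)`, `n ≥ 7`.** A TPP triple of `D_{2n}` either has volume `≤ 4⌊2n/3⌋` (the law),
or its volume is exactly `4⌊2n/3⌋ + 2` and `n = 3m²+3m+1` is a centred hexagonal number. [folklore] -/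
theorem tpp_volume_mod_one_dichotomy (hmod : n % 3 = 1) (hn : 7 ≤ n) (h : TripleProductProperty S T U) :
    S.card * T.card * U.card ≤ 4 * (2 * n / 3) ∨
      (S.card * T.card * U.card = 4 * (2 * n / 3) + 2 ∧ ∃ m : ℕ, n = 3 * m * m + 3 * m + 1) := by
  obtain ⟨h₀, h₃, h₁, h₂⟩ := dihedral_parts_counting h
  rw [card_eq_parts S, card_eq_parts T, card_eq_parts U]
  by_cases hV : 8 * n - 5 ≤ 3 * (((univ.filter fun i : ZMod n => r i ∈ S).card +
      (univ.filter fun i : ZMod n => sr i ∈ S).card) * (((univ.filter fun i : ZMod n => r i ∈ T).card +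
      (univ.filter fun i : ZMod n => sr i ∈ T).card)) * (((univ.filter fun i : ZMod n => r i ∈ U).card +
      (univ.filter fun i : ZMod n => sr i ∈ U).card)))
  · right
    obtain ⟨hvol, m, hm⟩ := core_nat_mod_one n _ _ _ _ _ _ hmod hn h₀ h₃ h₁ h₂ hV
    exact ⟨by omega, m, hm⟩
  · left
    omega

/-- **The law for non-hexagonal `n ≡ 1 (mod 3)`, `n ≥ 7`:** `|S||T||U| ≤ 4⌊2n/3⌋`. [folklore] -/
theorem tpp_volume_le_law_of_not_hex (hmod : n % 3 = 1) (hn : 7 ≤ n) (hhex : ∀ m : ℕ, n ≠ 3 * m * m + 3 * m + 1)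
    (h : TripleProductProperty S T U) : S.card * T.card * U.card ≤ 4 * (2 * n / 3) := by
  rcases tpp_volume_mod_one_dichotomy hmod hn h with hle | ⟨-, m, hm⟩
  · exact hle
  · exact absurd hm (hhex m)

/-- A volume exceeding the law is never `law + 1`: for `n ≡ 1 (mod 3)`, `n ≥ 7`, the only possible excess value
is `law + 2`. [folklore] -/
theorem tpp_volume_ne_law_add_one (hmod : n % 3 = 1) (hn : 7 ≤ n) (h : TripleProductProperty S T U) :
    S.card * T.card * U.card ≠ 4 * (2 * n / 3) + 1 := by
  rcases tpp_volume_mod_one_dichotomy hmod hn h with hle | ⟨heq, -⟩ <;> omega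

omit [NeZero n] in
/-- **The complete dihedral law away from centred hexagonal numbers.** For every `n ≥ 3` not of the form
`3m²+3m+1`: every TPP triple of `D_{2n}` has `|S||T||U| ≤ 4⌊2n/3⌋`, and this value is attained
(`dihedral_volume_ge_law`), i.e. `β(D_{2n}) = 4⌊2n/3⌋`.  Cases: `3 ∣ n` and `n ≡ 2` (`DihedralLawModThree.lean`),
`n = 4` (`Dihedral8TPPVolume.lean`), `n ≡ 1`, `n ≥ 7` (`tpp_volume_le_law_of_not_hex`). [folklore] -/
theorem dihedral_law_complete [NeZero n] (hn : 3 ≤ n) (hhex : ∀ m : ℕ, n ≠ 3 * m * m + 3 * m + 1) :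
    (∀ S T U : Finset (DihedralGroup n), TripleProductProperty S T U → S.card * T.card * U.card ≤ 4 * (2 * n / 3)) ∧
    ∃ S T U : Finset (DihedralGroup n), TripleProductProperty S T U ∧ S.card * T.card * U.card = 4 * (2 * n / 3) := by
  refine ⟨fun S T U h => ?_, ?_⟩
  · by_cases hmod : n % 3 = 1
    · by_cases h7 : 7 ≤ n
      · exact tpp_volume_le_law_of_not_hex hmod h7 hhex h
      · -- `n = 4`
        have h4 : n = 4 := by omega
        subst h4
        exact dihedral8_tpp_volume_le_eight S T U h
    · exact tpp_volume_le_law_of_mod_three hmod h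
  · obtain ⟨S, T, U, h, -, -, -, hvol⟩ := dihedral_volume_ge_law n hn
    exact ⟨S, T, U, h, hvol⟩

/-- At a centred hexagonal `n = 3m²+3m+1` (`m ≥ 1`) the kernel pins `β(D_{2n})` to `{4⌊2n/3⌋, 4⌊2n/3⌋+2}`:
every TPP triple has volume `≤ 4⌊2n/3⌋ + 2` and never `= 4⌊2n/3⌋ + 1`. [folklore] -/
theorem dihedral_law_hex (m : ℕ) (hm : 1 ≤ m) (hnm : n = 3 * m * m + 3 * m + 1) (h : TripleProductProperty S T U) :
    S.card * T.card * U.card ≤ 4 * (2 * n / 3) + 2 ∧ S.card * T.card * U.card ≠ 4 * (2 * n / 3) + 1 := by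
  obtain ⟨k, hk⟩ : ∃ k, 3 * m * m + 3 * m + 1 = 3 * k + 1 := ⟨m * m + m, by ring⟩
  have hk2 : 2 ≤ k := by nlinarith
  have hmod : n % 3 = 1 := by omega
  have h7 : 7 ≤ n := by omega
  refine ⟨?_, tpp_volume_ne_law_add_one hmod h7 h⟩
  have := tpp_volume_le_dihedral h
  omega

end Summit.MatrixMultiplication.OmegaCensus
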